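import Mathlib.Algebra.MvPolynomial.Funext
import Mathlib.LinearAlgebra.DirectSum.Finsupp
import Literature.NumberTheory.ComplexMultiplication.ReflexNormPoints
import Literature.NumberTheory.ComplexMultiplication.ReflexNormDeterminantTransitivity
import HarnessLib

/-!
# The reflex norm on `R`-points, III: PROPOSITION 1.23 in the torus form of REMARK 1.25 —
# `N_{k,Φ} = N_Φ ∘ Nm_{k/E*}` as homomorphisms `T^k → T^{E*} → T^E`, i.e. on `R`-points for EVERY commutative
# `ℚ`-algebra `R` (Milne, *Complex Multiplication*, Ch. I §1 Prop. 1.23, Rem. 1.25; §4 p. 33)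

Layer `Literature/NumberTheory/ComplexMultiplication`.  Sequel of `…ReflexNormPoints` (the reflex norm on `R`-points
`reflexNormPoints K Φ k R : R ⊗[ℚ] k →* R ⊗[ℚ] K`, `N_{k,Φ}(R)(a) = det_{E⊗R}(a | V_Φ ⊗_ℚ R)`, and its coordinate
determinant `baseChangeDet`) and of `…ReflexNormDeterminantTransitivity` (Prop. 1.23 on `ℚ`-points:
`reflexNormFrom_eq_reflexNormFrom_traceField_norm`).  Definitions with bodies (`normPoints`, `normPointsUnits`,
`pointsTowerAlgebra` — a reducible NON-instance `Algebra` structure —, `pointsTowerCombination`, `pointsTowerCoord`,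
`pointsTowerBasis`), two `Prop`-valued instances, theorems; no named fact (D-0026, net debt 0).

Written by the seat `hodge-director-flt-inv` (Track 2f of the Hodge programme, HOME `run/shared/lean/pub/hodge-director/`)
as the `R`-points half of the one item its adelic base-change packet left open: the idèlic form of (7) is the sequel
`…ReflexNormIdelesTransitivity` (`R = 𝔸_ℚ`).

## THE PRINT

J. S. Milne, *Complex Multiplication* (course notes, version of July 14, 2020) [MilneCM2006], Ch. I §1 «The reflex
norm», open text `paper:url-8ccc30e4daab`, verbatim (p0016 L6–L17, p0017 L2–L20):

> «More generally, for any `ℚ`-algebra `R` and invertible element `a` of `k ⊗_ℚ R`, we get an invertible element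
> `N_{k,Φ}(a) = det_{E⊗_ℚ R}(a | V_Φ ⊗_ℚ R)` of `E ⊗_ℚ R`.  In this way, we get a homomorphism
> `N_{k,Φ}(R) : (k ⊗_ℚ R)^× → (E ⊗_ℚ R)^×` which is functorial in `R` and independent of the choice of `V_Φ`. […]
> PROPOSITION 1.23 For any number field `k` with `E* ⊂ k ⊂ ℚ̄`, `N_{k,Φ} = N_Φ ∘ Nm_{k/E*}` (7).
> PROOF. Choose an `E ⊗_ℚ E*`-module `V_Φ` satisfying (6), and let `V′ = k ⊗_{E*} V_Φ`.  When we use `V′` to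
> compute `N_{k,Φ}`, and `V_Φ` to compute `N_Φ`, we obtain (7).
> REMARK 1.25 In terms of algebraic tori (see §4), `N_{k,Φ}` is a homomorphism `T^k → T^E`, where `T^k` and `T^E`
> are the algebraic tori over `ℚ` with `ℚ`-points `k^×` and `E^×` respectively (i.e., `T^k = (𝔾_m)_{k/ℚ}` and
> `T^E = (𝔾_m)_{E/ℚ}`). […] From `N_{k,Φ}` we obtain homomorphisms (by taking `R = ℚ, ℚ_ℓ, ℝ`):
> `N_0 : k^× → E^×`, `N_ℓ : k_ℓ^× → E_ℓ^×`, `N_∞ : k_∞^× → E_∞^×`.»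

and Ch. I §4 p. 33 (p0033 L9–L12): «For a finite field extension `K ⊃ k`, we let `(𝔾_m)_{K/k}` denote the torus
over `k` obtained by restriction of scalars from `𝔾_m` over `K`.  It represents the functor `R ⇝ (K ⊗_k R)^×`».

## READING

In the tree's vocabulary (`…ReflexNormDeterminant`, `…ReflexNormPoints`): `E = K` a number field,
`Φ : Motives.CMType K`, `E* = traceField Φ ⊂ ℂ`, `k : IntermediateField ℚ ℂ` a number field made an `E*`-algebra
compatibly with the two inclusions into `ℂ` (`[Algebra (traceField Φ) k] [IsScalarTower (traceField Φ) k ℂ]`, the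
setting of `reflexNormFrom_eq_reflexNormFrom_traceField_norm`), `R` a commutative `ℚ`-algebra written on the LEFT of
`⊗`.  Both sides of (7) are homomorphisms of algebraic tori over `ℚ`; a homomorphism of tori IS its functor of points
(Rem. 1.25: «by taking `R = ℚ, ℚ_ℓ, ℝ`»), so (7) SAYS: for every commutative `ℚ`-algebra `R` and every
`a ∈ k ⊗_ℚ R`, `N_{k,Φ}(R)(a) = N_Φ(R)(Nm_{k⊗R/E*⊗R}(a))`, where `Nm_{k/E*}` on `R`-points is the norm of the
restriction-of-scalars tori `T^k → T^{E*}`, `a ↦ det_{E*⊗R}(a | k ⊗_ℚ R)` (the determinant of multiplication by `a`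
on the free `E* ⊗_ℚ R`-module `k ⊗_ℚ R = k ⊗_{E*} (E* ⊗_ℚ R)`).  That is the statement proved here
(`reflexNormPoints_eq_reflexNormPoints_traceField_normPoints`), for ALL of `R ⊗_ℚ k` (the printed map on invertible
elements is the `Units.map`, `reflexNormPointsUnits_eq_comp`).

## WHAT IS PROVED, AND HOW

* §1 **THE NORM OF RESTRICTION-OF-SCALARS TORI ON `R`-POINTS** (generic: `F` a field of characteristic `0`, `k` a
  commutative `ℚ`-algebra finite over `F`, `R` any commutative `ℚ`-algebra): `normPoints F k R : R ⊗[ℚ] k →* R ⊗[ℚ] F`,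
  «`Nm_{k⊗R/F⊗R}(a) = det_{F⊗R}(a | k ⊗ R)`», DEFINED as the coordinate determinant `baseChangeDet` of
  `…ReflexNormPoints` for the regular representation of `k` on itself (`Algebra.lmul F k`) in an `F`-basis of `k` —
  the same construction as `N_{k,Φ}(R)` with `V_Φ` replaced by `k`; independent of the basis
  (`baseChangeDet_lmul_eq_normPoints`); `normPoints_tmul` **`Nm(r ⊗ a) = r^{[k:F]} ⊗ Nm_{k/F}(a)`**,
  `normPoints_one_tmul` (compatible with the field norm `Algebra.norm F` on `k ⊂ R ⊗ k`), **`normPoints_map`**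
  (natural in `R`); `normPointsUnits` (on invertible elements).
* §2 **`Nm_{k⊗R/F⊗R}` IS MATHLIB'S `Algebra.norm (R ⊗_ℚ F)`** for the `(R ⊗_ℚ F)`-algebra structure on `R ⊗_ℚ k`
  along `1 ⊗ (F ↪ k)` (`pointsTowerAlgebra`, a reducible non-instance definition made a local instance where needed —
  the structure `…AdelicBaseChange.AdeleNormTower.tensorTowerAlgebra ℚ F k` at `R = 𝔸_ℚ`, definitionally): the
  `(R ⊗ F)`-basis `1 ⊗ b_i` of `R ⊗ k` from an `F`-basis `b` of `k` (`pointsTowerBasis`, built from the explicit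
  coordinate map `pointsTowerCoord : r ⊗ a ↦ (r ⊗ b_i^*(a))_i` and the linear-combination map
  `pointsTowerCombination`, mutually inverse), `Module.Free` / `Module.Finite` of `R ⊗ k` over `R ⊗ F`,
  **`leftMulMatrix_pointsTowerBasis`** (the matrix of multiplication by `x` in the basis `1 ⊗ b` is the coordinate
  action matrix `baseChangeRep b lmul R x`) and **`norm_eq_normPoints`**: `Algebra.norm (R ⊗_ℚ F) x = normPoints F k R x`.
* §3 **THE DENSITY LEMMA** `pointsMap_eq_of_natural_of_eq_base` (generic: `F₀` an infinite field, `k` a finite and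
  `K` any `F₀`-vector space): two families of maps `η_R, θ_R : R ⊗_{F₀} k → R ⊗_{F₀} K`, natural in the commutative
  `F₀`-algebra `R`, which agree for `R = F₀`, agree for every `R` — «a morphism of functors of points
  `Res_{k/F₀}𝔸¹ → Res_{K/F₀}𝔸¹` is determined on `F₀`-points» (they are Zariski dense).  Proof (Yoneda): every
  `x ∈ R ⊗ k` is the image of the universal element `ξ = Σ_i X_i ⊗ b_i ∈ F₀[X] ⊗ k` under the evaluation `X_i ↦ x_i`,
  so `η` is determined by `η(ξ) ∈ F₀[X] ⊗ K`, whose coordinates in the basis `1 ⊗ c` (`c` a basis of `K`) are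
  polynomials over `F₀`; their values at `q ∈ F₀^n` are the coordinates of `η_{F₀}(Σ q_i b_i)` (naturality along
  `X ↦ q`, `basis_repr_rTensor`), and a polynomial over an infinite field is determined by its values
  (Mathlib `MvPolynomial.funext`).  Corollary `pointsMap_eq_of_natural_of_eq_base'` phrased with
  `Algebra.TensorProduct.map φ (AlgHom.id _ _)` for algebras `k`, `K` (the form of `reflexNormPoints_map`).
* §4 **PROPOSITION 1.23 ON `R`-POINTS** `reflexNormPoints_eq_reflexNormPoints_traceField_normPoints`:
  **`N_{k,Φ}(R)(x) = N_Φ(R)(Nm_{k⊗R/E*⊗R}(x))`** for every commutative `ℚ`-algebra `R` and every `x ∈ R ⊗_ℚ k`; as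
  monoid homomorphisms `reflexNormPoints_eq_comp_normPoints`; on invertible elements (the printed
  `(k ⊗ R)^× → (E* ⊗ R)^× → (E ⊗ R)^×`) `reflexNormPointsUnits_eq_comp`; and with `Nm` read as Mathlib's
  `Algebra.norm (R ⊗ E*)` `reflexNormPoints_eq_reflexNormPoints_traceField_norm`.
  PROOF: by §3 — both sides are natural in `R` (`reflexNormPoints_map`, `normPoints_map`) and agree at `R = ℚ`,
  where `x = 1 ⊗ a` and the identity is `1 ⊗ (7)` for elements: `N_ℚ(1 ⊗ a) = 1 ⊗ N_{k,Φ}(a)`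
  (`reflexNormPoints_one_tmul`), `Nm(1 ⊗ a) = 1 ⊗ Nm_{k/E*}(a)` (`normPoints_one_tmul`), and
  `N_{k,Φ}(a) = N_Φ(Nm_{k/E*} a)` (`reflexNormFrom_eq_reflexNormFrom_traceField_norm`).
  DEVIATION from the printed proof, which computes `N_{k,Φ}(R)` with the module `V′ = k ⊗_{E*} V_Φ` (allowed by
  «independent of the choice of `V_Φ`», the tree's `baseChangeDet_eq_reflexNormPoints`) and then needs the determinant
  of a block matrix with commuting blocks (Silvester; Mathlib `Matrix.det_det`): since (7) on `ℚ`-points is already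
  in the tree, the density of `k^× = T^k(ℚ)` in `T^k` is the shorter road, and §3 is reusable for every identity
  between homomorphisms of such tori stated on points.

NOT HERE: the adèles / idèles / idèle classes (`R = 𝔸_ℚ`; the sequel `…ReflexNormIdelesTransitivity`); the
comparison of `normPoints` with the lane's Serre-group-side norm of tori `RestrictionTorusNormPoints.normUnits`
(written `K ⊗_k R`, field on the left, through a Galois splitting field).

## References

* [MilneCM2006] J. S. Milne, *Complex Multiplication* (course notes; version July 14, 2020), Ch. I §1 «The reflex
  norm»: p. 16 («More generally, for any ℚ-algebra R»), Prop. 1.23 with proof, Rem. 1.25; Ch. I §4 p. 33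
  («(𝔾_m)_{K/k} … represents the functor R ⇝ (K ⊗_k R)^×») (`paper:url-8ccc30e4daab` p0016, p0017, p0033).
* [Shimura1998] G. Shimura, *Abelian Varieties with Complex Multiplication and Modular Functions*, Princeton 1998,
  §18.5 p. 123 («Naturally Φ⁰ can be extended … ℚ_𝐀-linearly») — the case `R = ℚ_𝐀` of the sequel.

## Provenance

Hodge programme Track 2f, seat `hodge-director-flt-inv` gen 27 (agent `literature-prover-hodge-director-flt-inv-g27-0`),
2026-08-22; consumes BY NAME p27's `…ReflexNormPoints` (gen 4) and `…ReflexNormDeterminantTransitivity` (gen 4) of the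
lane `lit-hodgefound`.
-/

set_option autoImplicit false

noncomputable section

open scoped TensorProduct IntermediateField

namespace Literature.NumberTheory.ComplexMultiplication

open Literature.AlgebraicGeometry.GaoUllmo2025
open Literature.AlgebraicGeometry.Motives (CMType)
open Module

/-! ## §1 The norm `Nm_{k⊗R/F⊗R}` of the restriction-of-scalars tori `T^k → T^F` on `R`-points -/

section NormPoints

variable (F k : Type) [Field F] [CharZero F] [CommRing k] [Algebra ℚ k] [Algebra F k] [Module.Finite F k]
variable (R : Type) [CommRing R] [Algebra ℚ R]

/-- **THE NORM OF THE RESTRICTION-OF-SCALARS TORI ON `R`-POINTS, `Nm_{k/F}(R) : k ⊗_ℚ R → F ⊗_ℚ R`**: for a field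
`F` of characteristic `0`, a commutative `ℚ`-algebra `k` finite over `F` (a finite extension `k ⊃ F` of number
fields in the applications) and any commutative `ℚ`-algebra `R` (written on the left of `⊗`), the map
`a ↦ det_{F⊗R}(a | k ⊗_ℚ R)` — the determinant over `R ⊗_ℚ F` of multiplication by `a ∈ R ⊗_ℚ k` on the free
`R ⊗_ℚ F`-module `R ⊗_ℚ k ≅ (R ⊗_ℚ F)^{[k:F]}`, as a monoid homomorphism on all of `R ⊗_ℚ k`.  It is the coordinate
determinant `baseChangeDet` of `…ReflexNormPoints` for the regular representation `Algebra.lmul F k` of `k` on itself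
in an `F`-basis (independent of the basis: `baseChangeDet_lmul_eq_normPoints`); it IS Mathlib's `Algebra.norm (R ⊗ F)`
for the natural `(R ⊗ F)`-algebra structure on `R ⊗ k` (`norm_eq_normPoints`), and natural in `R`
(`normPoints_map`) — the functor of points of the norm homomorphism of tori `Nm_{k/F} : T^k = (𝔾_m)_{k/ℚ} →
T^F = (𝔾_m)_{F/ℚ}` («`(𝔾_m)_{K/k}` … represents the functor `R ⇝ (K ⊗_k R)^×`»), the map written `Nm_{k/E*}` in (7).
[cite: MilneCM2006, Ch. I §1 Prop. 1.23 (7) and Rem. 1.25; Ch. I §4 p. 33] -/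
def normPoints : R ⊗[ℚ] k →* R ⊗[ℚ] F :=
  baseChangeDet (Module.finBasis F k) ((Algebra.lmul F k : k →ₐ[F] Module.End F k) : k →+* Module.End F k) R

/-- Unfolding. [cite: MilneCM2006, Ch. I §1 Prop. 1.23 (7)] -/
theorem normPoints_def : normPoints F k R =
    baseChangeDet (Module.finBasis F k) ((Algebra.lmul F k : k →ₐ[F] Module.End F k) : k →+* Module.End F k) R :=
  rfl

/-- **Independence of the basis**: EVERY finite `F`-basis `b` of `k` computes `Nm_{k/F}(R)` as the determinant of the
coordinate action matrix `baseChangeRep b lmul R` (`baseChangeDet_eq_of_basis`).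
[cite: MilneCM2006, Ch. I §1 (p. 16, «independent of the choice»)] -/
theorem baseChangeDet_lmul_eq_normPoints {ι : Type} [Fintype ι] [DecidableEq ι] (b : Basis ι F k) :
    baseChangeDet b ((Algebra.lmul F k : k →ₐ[F] Module.End F k) : k →+* Module.End F k) R = normPoints F k R :=
  baseChangeDet_eq_of_basis _ _ R _

/-- **On pure tensors `Nm(r ⊗ a) = r^{[k:F]} ⊗ Nm_{k/F}(a)`**, with Mathlib's field norm `Algebra.norm F : k →* F`
(`baseChangeDet_tmul`: the scalar `r` acts on a free module of rank `[k:F]`, and `det_F(a | k) = Nm_{k/F}(a)` is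
`Algebra.norm_apply`). [cite: MilneCM2006, Ch. I §1 Rem. 1.25 («compatible with N_0»)] -/
theorem normPoints_tmul (r : R) (a : k) :
    normPoints F k R (r ⊗ₜ a) = (r ^ finrank F k) ⊗ₜ Algebra.norm F a := by
  rw [normPoints_def, baseChangeDet_tmul, Fintype.card_fin, Algebra.norm_apply]
  rfl

/-- **`Nm(1 ⊗ a) = 1 ⊗ Nm_{k/F}(a)`**: on `k ⊂ R ⊗_ℚ k` the `R`-points norm is the field norm `Nm_{k/F}`
(«compatible with `N_0`»; for `R = ℚ` it IS `Nm_{k/F}` under `ℚ ⊗_ℚ k = k`).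
[cite: MilneCM2006, Ch. I §1 Rem. 1.25 («by taking R = ℚ»)] -/
theorem normPoints_one_tmul (a : k) : normPoints F k R (1 ⊗ₜ a) = 1 ⊗ₜ Algebra.norm F a := by
  rw [normPoints_tmul, one_pow]

variable {R} {R' : Type} [CommRing R'] [Algebra ℚ R']

/-- **`Nm_{k/F}` on points is natural in `R`** (a homomorphism of tori `T^k → T^F`): for every homomorphism of
commutative `ℚ`-algebras `φ : R → R'`, `Nm_{R'}((φ ⊗ 1) x) = (φ ⊗ 1)(Nm_R x)` (`baseChangeDet_map`).
[cite: MilneCM2006, Ch. I §1 (p. 16, «functorial in R») and Rem. 1.25] -/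
theorem normPoints_map (φ : R →ₐ[ℚ] R') (x : R ⊗[ℚ] k) :
    normPoints F k R' (Algebra.TensorProduct.map φ (AlgHom.id ℚ k) x) =
      Algebra.TensorProduct.map φ (AlgHom.id ℚ F) (normPoints F k R x) := by
  rw [normPoints_def, normPoints_def, baseChangeDet_map]

variable (R)

/-- **`Nm_{k/F}(R) : (k ⊗_ℚ R)^× → (F ⊗_ℚ R)^×`**, the printed map on invertible elements — the `R`-points of the norm
homomorphism of tori `T^k → T^F` (`Units.map normPoints`).
[cite: MilneCM2006, Ch. I §1 Rem. 1.25; Ch. I §4 p. 33 («represents the functor R ⇝ (K ⊗_k R)^×»)] -/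
def normPointsUnits : (R ⊗[ℚ] k)ˣ →* (R ⊗[ℚ] F)ˣ := Units.map (normPoints F k R)

/-- [cite: MilneCM2006, Ch. I §1 Rem. 1.25] -/
@[simp] theorem coe_normPointsUnits (x : (R ⊗[ℚ] k)ˣ) :
    (normPointsUnits F k R x : R ⊗[ℚ] F) = normPoints F k R x := rfl

end NormPoints

/-! ## §2 `Nm_{k⊗R/F⊗R}` is Mathlib's `Algebra.norm (R ⊗_ℚ F)`: the `(R ⊗ F)`-basis `1 ⊗ b` of `R ⊗ k` -/

section Tower

variable (F k : Type) [Field F] [CharZero F] [CommRing k] [Algebra ℚ k] [Algebra F k] [IsScalarTower ℚ F k]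
variable (R : Type) [CommRing R] [Algebra ℚ R]

/-- **The `(R ⊗_ℚ F)`-algebra structure on `R ⊗_ℚ k` along `1 ⊗ (F → k)`** (`r ⊗ f ↦ r ⊗ f`, `f` read in `k`) —
the structure for which `R ⊗_ℚ k = (R ⊗_ℚ F) ⊗_F k` is the base change of `k/F` to `R ⊗_ℚ F`.  A reducible
NON-instance definition (like Mathlib's `Algebra.TensorProduct.rightAlgebra`), made a local instance where needed;
it overrides nothing (Mathlib has no `Algebra (R ⊗ F) (R ⊗ k)` instance).  At `R = 𝔸_ℚ` it is, definitionally, the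
structure `…AdelicBaseChange.tensorTowerAlgebra ℚ F k` of `AdeleNormTower.lean` under which the adelic norm
`N_{k/F}` is read on `𝔸_ℚ ⊗_ℚ k` (`adeleRelNorm_adeleRingTensorAlgEquiv`).
[cite: MilneCM2006, Ch. I §1 Prop. 1.23 (proof, «V′ = k ⊗_{E*} V_Φ»)] -/
abbrev pointsTowerAlgebra : Algebra (R ⊗[ℚ] F) (R ⊗[ℚ] k) :=
  (Algebra.TensorProduct.map (AlgHom.id R R) (IsScalarTower.toAlgHom ℚ F k)).toRingHom.toAlgebra

attribute [local instance] pointsTowerAlgebra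

/-- Unfolding: the structure map is `1 ⊗ (F → k)` (`Algebra.TensorProduct.map id ι`).
[cite: MilneCM2006, Ch. I §1 Prop. 1.23 (proof)] -/
theorem pointsTowerAlgebra_algebraMap_apply (x : R ⊗[ℚ] F) :
    algebraMap (R ⊗[ℚ] F) (R ⊗[ℚ] k) x =
      Algebra.TensorProduct.map (AlgHom.id R R) (IsScalarTower.toAlgHom ℚ F k) x :=
  rfl

/-- On pure tensors the structure map is `r ⊗ f ↦ r ⊗ f`. [cite: MilneCM2006, Ch. I §1 Prop. 1.23 (proof)] -/
theorem pointsTowerAlgebra_algebraMap_tmul (r : R) (f : F) :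
    algebraMap (R ⊗[ℚ] F) (R ⊗[ℚ] k) (r ⊗ₜ f) = r ⊗ₜ algebraMap F k f :=
  rfl

/-- The scalar action: `x • y = (1 ⊗ ι)(x) · y`. [cite: MilneCM2006, Ch. I §1 Prop. 1.23 (proof)] -/
theorem pointsTowerAlgebra_smul_def (x : R ⊗[ℚ] F) (y : R ⊗[ℚ] k) :
    x • y = Algebra.TensorProduct.map (AlgHom.id R R) (IsScalarTower.toAlgHom ℚ F k) x * y :=
  Algebra.smul_def x y

/-- On pure tensors: `(r ⊗ f) • (s ⊗ a) = rs ⊗ f a`. [cite: MilneCM2006, Ch. I §1 Prop. 1.23 (proof)] -/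
theorem pointsTowerAlgebra_tmul_smul_tmul (r : R) (f : F) (s : R) (a : k) :
    (r ⊗ₜ[ℚ] f) • (s ⊗ₜ[ℚ] a) = (r * s) ⊗ₜ[ℚ] (f • a) := by
  rw [pointsTowerAlgebra_smul_def, Algebra.TensorProduct.map_tmul, AlgHom.id_apply, IsScalarTower.coe_toAlgHom',
    Algebra.TensorProduct.tmul_mul_tmul, Algebra.smul_def]

/-- `R → R ⊗ F → R ⊗ k` is a scalar tower (`(r ⊗ 1) ↦ r ⊗ 1`). [cite: MilneCM2006, Ch. I §1 Prop. 1.23 (proof)] -/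
instance pointsTowerAlgebra_isScalarTower : IsScalarTower R (R ⊗[ℚ] F) (R ⊗[ℚ] k) :=
  IsScalarTower.of_algebraMap_eq fun r => by
    rw [Algebra.TensorProduct.algebraMap_apply, Algebra.TensorProduct.algebraMap_apply,
      pointsTowerAlgebra_algebraMap_tmul, map_one]

variable {ι : Type}

/-- The `(R ⊗ F)`-linear combination map `(ι →₀ R ⊗_ℚ F) → R ⊗_ℚ k`, `g ↦ Σ_i g_i • (1 ⊗ b_i)`, for a family `b`
(Mathlib `Finsupp.linearCombination`); for an `F`-basis `b` of `k` it is bijective with inverse `pointsTowerCoord`.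
[cite: MilneCM2006, Ch. I §1 Prop. 1.23 (proof)] -/
def pointsTowerCombination (b : Basis ι F k) : (ι →₀ R ⊗[ℚ] F) →ₗ[R ⊗[ℚ] F] R ⊗[ℚ] k :=
  Finsupp.linearCombination (R ⊗[ℚ] F) fun i => (1 : R) ⊗ₜ[ℚ] b i

/-- `(r ⊗ f) • (1 ⊗ b_i) = r ⊗ f b_i`. [cite: MilneCM2006, Ch. I §1 Prop. 1.23 (proof)] -/
theorem pointsTowerCombination_single (b : Basis ι F k) (i : ι) (r : R) (f : F) :
    pointsTowerCombination F k R b (Finsupp.single i (r ⊗ₜ f)) = r ⊗ₜ (f • b i) := by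
  rw [pointsTowerCombination, Finsupp.linearCombination_single, pointsTowerAlgebra_tmul_smul_tmul, mul_one]

variable [DecidableEq ι]

/-- The coordinate map `R ⊗_ℚ k → (ι →₀ R ⊗_ℚ F)`, `r ⊗ a ↦ (r ⊗ b_i^*(a))_i` (`ℚ`-linear: `1 ⊗ b.repr`
followed by Mathlib's `TensorProduct.finsuppRight`, `R ⊗ (ι →₀ F) ≅ ι →₀ R ⊗ F`).
[cite: MilneCM2006, Ch. I §1 Prop. 1.23 (proof)] -/
def pointsTowerCoord (b : Basis ι F k) : R ⊗[ℚ] k →ₗ[ℚ] (ι →₀ R ⊗[ℚ] F) :=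
  (TensorProduct.finsuppRight ℚ ℚ R F ι : R ⊗[ℚ] (ι →₀ F) ≃ₗ[ℚ] ι →₀ R ⊗[ℚ] F).toLinearMap ∘ₗ
    LinearMap.lTensor R (b.repr.toLinearMap.restrictScalars ℚ)

/-- `pointsTowerCoord (r ⊗ a) = Σ_i single i (r ⊗ b_i^*(a))`. [cite: MilneCM2006, Ch. I §1 Prop. 1.23 (proof)] -/
theorem pointsTowerCoord_tmul (b : Basis ι F k) (r : R) (a : k) :
    pointsTowerCoord F k R b (r ⊗ₜ a) = (b.repr a).sum fun i f => Finsupp.single i (r ⊗ₜ[ℚ] f) := by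
  rw [pointsTowerCoord, LinearMap.comp_apply, LinearMap.lTensor_tmul, LinearEquiv.coe_toLinearMap,
    LinearMap.coe_restrictScalars, LinearEquiv.coe_toLinearMap, TensorProduct.finsuppRight_apply_tmul]

/-- The `i`-th coordinate of `r ⊗ a` is `r ⊗ b_i^*(a)`. [cite: MilneCM2006, Ch. I §1 Prop. 1.23 (proof)] -/
theorem pointsTowerCoord_tmul_apply (b : Basis ι F k) (r : R) (a : k) (i : ι) :
    pointsTowerCoord F k R b (r ⊗ₜ a) i = r ⊗ₜ[ℚ] b.repr a i := by
  rw [pointsTowerCoord, LinearMap.comp_apply, LinearMap.lTensor_tmul, LinearEquiv.coe_toLinearMap,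
    LinearMap.coe_restrictScalars, LinearEquiv.coe_toLinearMap, TensorProduct.finsuppRight_apply_tmul_apply]

/-- `Σ_i (r ⊗ b_i^*(a)) • (1 ⊗ b_i) = r ⊗ a`: the linear-combination map is a left inverse of the coordinate map
(`b.linearCombination_repr`). [cite: MilneCM2006, Ch. I §1 Prop. 1.23 (proof)] -/
theorem pointsTowerCombination_coord (b : Basis ι F k) (x : R ⊗[ℚ] k) :
    pointsTowerCombination F k R b (pointsTowerCoord F k R b x) = x := by
  induction x using TensorProduct.induction_on with
  | zero => rw [map_zero, map_zero]
  | tmul r a =>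
      rw [pointsTowerCoord_tmul, map_finsuppSum]
      simp_rw [pointsTowerCombination_single]
      conv_rhs => rw [← b.linearCombination_repr a, Finsupp.linearCombination_apply]
      rw [Finsupp.sum, Finsupp.sum, TensorProduct.tmul_sum]
  | add x y hx hy => rw [map_add, map_add, hx, hy]

/-- The coordinates of `t • (1 ⊗ b_i)` are `single i t`. [cite: MilneCM2006, Ch. I §1 Prop. 1.23 (proof)] -/
theorem pointsTowerCoord_combination_single (b : Basis ι F k) (i : ι) (t : R ⊗[ℚ] F) :
    pointsTowerCoord F k R b (pointsTowerCombination F k R b (Finsupp.single i t)) = Finsupp.single i t := by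
  induction t using TensorProduct.induction_on with
  | zero => rw [Finsupp.single_zero, map_zero, map_zero]
  | tmul r f =>
      rw [pointsTowerCombination_single]
      refine Finsupp.ext fun j => ?_
      rw [pointsTowerCoord_tmul_apply, map_smul, Basis.repr_self, Finsupp.smul_single, smul_eq_mul, mul_one,
        Finsupp.single_apply, Finsupp.single_apply]
      split_ifs with h
      · rfl
      · rw [TensorProduct.tmul_zero]
  | add x y hx hy => rw [Finsupp.single_add, map_add, map_add, hx, hy]

/-- The coordinate map is a left inverse of the linear-combination map. [cite: MilneCM2006, Ch. I §1 Prop. 1.23 (proof)] -/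
theorem pointsTowerCoord_combination (b : Basis ι F k) (g : ι →₀ R ⊗[ℚ] F) :
    pointsTowerCoord F k R b (pointsTowerCombination F k R b g) = g := by
  induction g using Finsupp.induction with
  | zero => rw [map_zero, map_zero]
  | single_add i t g _ _ ih => rw [map_add, map_add, pointsTowerCoord_combination_single, ih]

/-- **THE `(R ⊗_ℚ F)`-BASIS `1 ⊗ b_i` OF `R ⊗_ℚ k`** from an `F`-basis `b` of `k` — «`k ⊗_ℚ R` is the base change
of `k` to `F ⊗_ℚ R`», the freeness behind `det_{F⊗R}(a | k ⊗ R)`.  (Defined through the bijective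
`(R ⊗ F)`-linear map `pointsTowerCombination`; `pointsTowerBasis_apply`, `pointsTowerBasis_repr_tmul`.)
[cite: MilneCM2006, Ch. I §1 Prop. 1.23 (proof, «V′ = k ⊗_{E*} V_Φ»)] -/
def pointsTowerBasis (b : Basis ι F k) : Basis ι (R ⊗[ℚ] F) (R ⊗[ℚ] k) :=
  Basis.ofRepr
    (LinearEquiv.ofBijective (pointsTowerCombination F k R b)
      ⟨fun g g' h => by
        have h' := congrArg (pointsTowerCoord F k R b) h
        rwa [pointsTowerCoord_combination, pointsTowerCoord_combination] at h',
       fun x => ⟨pointsTowerCoord F k R b x, pointsTowerCombination_coord F k R b x⟩⟩).symm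

/-- The coordinates in the basis `1 ⊗ b` are `pointsTowerCoord`. [cite: MilneCM2006, Ch. I §1 Prop. 1.23 (proof)] -/
theorem pointsTowerBasis_repr_apply (b : Basis ι F k) (x : R ⊗[ℚ] k) :
    (pointsTowerBasis F k R b).repr x = pointsTowerCoord F k R b x := by
  change (LinearEquiv.ofBijective (pointsTowerCombination F k R b) _).symm x = _
  rw [LinearEquiv.symm_apply_eq, LinearEquiv.ofBijective_apply, pointsTowerCombination_coord]

/-- **The basis vectors are `1 ⊗ b_i`.** [cite: MilneCM2006, Ch. I §1 Prop. 1.23 (proof)] -/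
theorem pointsTowerBasis_apply (b : Basis ι F k) (i : ι) : pointsTowerBasis F k R b i = (1 : R) ⊗ₜ[ℚ] b i := by
  apply (pointsTowerBasis F k R b).repr.injective
  rw [Basis.repr_self, pointsTowerBasis_repr_apply, pointsTowerCoord_tmul, Basis.repr_self,
    Finsupp.sum_single_index (by rw [TensorProduct.tmul_zero, Finsupp.single_zero])]
  rfl

/-- **Coordinates of a pure tensor: `(r ⊗ a)_i = r ⊗ b_i^*(a)`.** [cite: MilneCM2006, Ch. I §1 Prop. 1.23 (proof)] -/
theorem pointsTowerBasis_repr_tmul (b : Basis ι F k) (r : R) (a : k) (i : ι) :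
    (pointsTowerBasis F k R b).repr (r ⊗ₜ a) i = r ⊗ₜ[ℚ] b.repr a i := by
  rw [pointsTowerBasis_repr_apply, pointsTowerCoord_tmul_apply]

/-- `R ⊗_ℚ k` is a free `R ⊗_ℚ F`-module (for `k` finite over the field `F`).
[cite: MilneCM2006, Ch. I §1 Prop. 1.23 (proof)] -/
instance pointsTowerAlgebra_free [Module.Finite F k] : Module.Free (R ⊗[ℚ] F) (R ⊗[ℚ] k) :=
  Module.Free.of_basis (pointsTowerBasis F k R (Module.finBasis F k))

/-- `R ⊗_ℚ k` is a finite `R ⊗_ℚ F`-module (for `k` finite over `F`). [cite: MilneCM2006, Ch. I §1 Prop. 1.23 (proof)] -/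
instance pointsTowerAlgebra_finite [Module.Finite F k] : Module.Finite (R ⊗[ℚ] F) (R ⊗[ℚ] k) :=
  Module.Finite.of_basis (pointsTowerBasis F k R (Module.finBasis F k))

variable [Fintype ι]

/-- **The matrix of multiplication by `x ∈ R ⊗ k` in the basis `1 ⊗ b` is the coordinate action matrix
`baseChangeRep b lmul R x`** of `…ReflexNormPoints` (on `r ⊗ a`: `(r ⊗ a)(1 ⊗ b_j) = r ⊗ a b_j` has `i`-th
coordinate `r ⊗ [a]_{b,ij}`). [cite: MilneCM2006, Ch. I §1 Prop. 1.23 (proof)] -/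
theorem leftMulMatrix_pointsTowerBasis (b : Basis ι F k) (x : R ⊗[ℚ] k) :
    Algebra.leftMulMatrix (pointsTowerBasis F k R b) x =
      baseChangeRep b ((Algebra.lmul F k : k →ₐ[F] Module.End F k) : k →+* Module.End F k) R x := by
  induction x using TensorProduct.induction_on with
  | zero => rw [map_zero, map_zero]
  | tmul r a =>
      ext i j
      rw [Algebra.leftMulMatrix_eq_repr_mul, pointsTowerBasis_apply, Algebra.TensorProduct.tmul_mul_tmul, mul_one,
        pointsTowerBasis_repr_tmul, baseChangeRep_tmul, Matrix.map_apply, LinearMap.toMatrix_apply]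
      rfl
  | add x y hx hy => rw [map_add, map_add, hx, hy]

/-- **`Nm_{(R⊗k)/(R⊗F)} = normPoints`**: Mathlib's norm of the finite free `(R ⊗_ℚ F)`-algebra `R ⊗_ℚ k` IS
`det_{F⊗R}(· | k ⊗ R)` (`Algebra.norm_eq_matrix_det` in the basis `1 ⊗ b`, `leftMulMatrix_pointsTowerBasis`).
[cite: MilneCM2006, Ch. I §1 Prop. 1.23 (7) («Nm_{k/E*}») and Rem. 1.25] -/
theorem norm_eq_normPoints [Module.Finite F k] (x : R ⊗[ℚ] k) :
    Algebra.norm (R ⊗[ℚ] F) x = normPoints F k R x := by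
  classical
  rw [Algebra.norm_eq_matrix_det (pointsTowerBasis F k R (Module.finBasis F k)), leftMulMatrix_pointsTowerBasis,
    normPoints_def, baseChangeDet_apply]

end Tower

/-! ## §3 The density lemma: natural families of maps `R ⊗ k → R ⊗ K` are determined on base-field points -/

section Naturality

variable {S : Type} [CommSemiring S] {A A' : Type} [CommSemiring A] [Algebra S A] [CommSemiring A'] [Algebra S A']
  {M : Type} [AddCommMonoid M] [Module S M] {ι : Type}

/-- **Coordinates in the basis `1 ⊗ c` are natural in the coefficient algebra**: for an `S`-algebra homomorphism
`φ : A → A'`, an `S`-basis `c` of `M` and `y ∈ A ⊗_S M`, the `i`-th coordinate of `(φ ⊗ 1) y` in the `A'`-basis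
`1 ⊗ c` is `φ` of the `i`-th coordinate of `y` in the `A`-basis `1 ⊗ c` (Mathlib `Algebra.TensorProduct.basis`; on
`a ⊗ m` both are `φ(a) · c_i^*(m)`). [folklore] -/
private theorem basis_repr_rTensor (c : Basis ι S M) (φ : A →ₐ[S] A') (y : A ⊗[S] M) (i : ι) :
    (Algebra.TensorProduct.basis A' c).repr (LinearMap.rTensor M φ.toLinearMap y) i =
      φ ((Algebra.TensorProduct.basis A c).repr y i) := by
  induction y using TensorProduct.induction_on with
  | zero => simp only [map_zero, Finsupp.zero_apply]
  | tmul a m =>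
      rw [LinearMap.rTensor_tmul, AlgHom.toLinearMap_apply, Algebra.TensorProduct.basis_repr_tmul,
        Algebra.TensorProduct.basis_repr_tmul, Finsupp.smul_apply, Finsupp.smul_apply, Finsupp.mapRange_apply,
        Finsupp.mapRange_apply, smul_eq_mul, smul_eq_mul, map_mul, AlgHom.commutes]
  | add x y hx hy => simp only [map_add, Finsupp.add_apply, hx, hy]

end Naturality

section Density

variable {F₀ : Type} [Field F₀] [Infinite F₀]
variable {k K : Type} [AddCommGroup k] [Module F₀ k] [Module.Finite F₀ k] [AddCommGroup K] [Module F₀ K]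

/-- **THE DENSITY LEMMA — a morphism of functors of points `R ⇝ R ⊗ k → R ⊗ K` is determined on `F₀`-points.**
Let `F₀` be an infinite field, `k` a finite-dimensional and `K` an arbitrary `F₀`-vector space, and let
`η_R, θ_R : R ⊗_{F₀} k → R ⊗_{F₀} K` be two families of maps indexed by the commutative `F₀`-algebras `R`, both
natural in `R` (`η_S ∘ (φ ⊗ 1) = (φ ⊗ 1) ∘ η_R` for every `F₀`-algebra homomorphism `φ : R → S`).  If
`η_{F₀} = θ_{F₀}` then `η_R = θ_R` for every `R`.  (For `k`, `K` number fields: two homomorphisms — or any two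
natural transformations — between the Weil restrictions `T^k → T^K` that agree on `k = T^k(ℚ)` are equal; `T^k(ℚ)`
is Zariski dense in `T^k`.)  Proof by the universal element `ξ = Σ_i X_i ⊗ b_i ∈ F₀[X_1,…,X_n] ⊗ k` (`b` a basis of
`k`): `x = (ev_x ⊗ 1) ξ` for every `x ∈ R ⊗ k`, so `η_R(x) = (ev_x ⊗ 1) η(ξ)` and it suffices that `η(ξ) = θ(ξ)` in
`F₀[X] ⊗ K`; their coordinates in the basis `1 ⊗ c` are polynomials over `F₀` whose values at `q ∈ F₀^n` are the
coordinates of `η_{F₀}((ev_q ⊗ 1) ξ) = θ_{F₀}((ev_q ⊗ 1) ξ)` (`basis_repr_rTensor`), hence equal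
(Mathlib `MvPolynomial.funext`, `F₀` infinite).  This is the tool by which (7) on `R`-points is deduced from (7) on
`ℚ`-points («by taking `R = ℚ`»). [cite: MilneCM2006, Ch. I §1 Rem. 1.25 («In terms of algebraic tori … N_{k,Φ} is a homomorphism T^k → T^E … by taking R = ℚ, ℚ_ℓ, ℝ»)] -/
theorem pointsMap_eq_of_natural_of_eq_base
    (η θ : ∀ (R : Type) [CommRing R] [Algebra F₀ R], R ⊗[F₀] k → R ⊗[F₀] K)
    (hη : ∀ (R S : Type) [CommRing R] [Algebra F₀ R] [CommRing S] [Algebra F₀ S] (φ : R →ₐ[F₀] S)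
      (x : R ⊗[F₀] k), η S (LinearMap.rTensor k φ.toLinearMap x) = LinearMap.rTensor K φ.toLinearMap (η R x))
    (hθ : ∀ (R S : Type) [CommRing R] [Algebra F₀ R] [CommRing S] [Algebra F₀ S] (φ : R →ₐ[F₀] S)
      (x : R ⊗[F₀] k), θ S (LinearMap.rTensor k φ.toLinearMap x) = LinearMap.rTensor K φ.toLinearMap (θ R x))
    (h : ∀ x : F₀ ⊗[F₀] k, η F₀ x = θ F₀ x)
    (R : Type) [CommRing R] [Algebra F₀ R] (x : R ⊗[F₀] k) : η R x = θ R x := by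
  classical
  -- a basis of `k`, the universal ring `U = F₀[X_i]` and the universal element `ξ = Σ X_i ⊗ b_i`
  let b : Basis (Fin (finrank F₀ k)) F₀ k := Module.finBasis F₀ k
  let U : Type := MvPolynomial (Fin (finrank F₀ k)) F₀
  let ξ : U ⊗[F₀] k := ∑ i, (MvPolynomial.X i : U) ⊗ₜ[F₀] b i
  -- every `x ∈ R ⊗ k` is the image of `ξ` under the evaluation `X_i ↦ x_i`
  have hx : ∀ (R : Type) [CommRing R] [Algebra F₀ R] (x : R ⊗[F₀] k),
      LinearMap.rTensor k (MvPolynomial.aeval (R := F₀)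
        (fun i => (Algebra.TensorProduct.basis R b).repr x i)).toLinearMap ξ = x := by
    intro R _ _ x
    simp only [ξ, map_sum, LinearMap.rTensor_tmul, AlgHom.toLinearMap_apply, MvPolynomial.aeval_X]
    conv_rhs => rw [← (Algebra.TensorProduct.basis R b).sum_repr x]
    refine Finset.sum_congr rfl fun i _ => ?_
    rw [Algebra.TensorProduct.basis_apply, TensorProduct.smul_tmul', smul_eq_mul, mul_one]
  -- so it suffices to compare the two images of `ξ`
  suffices hξ : η U ξ = θ U ξ by
    rw [← hx R x, hη, hθ, hξ]
  -- compare coordinates in the `U`-basis `1 ⊗ c` of `U ⊗ K`, `c` a basis of `K`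
  let c := Module.Free.chooseBasis F₀ K
  apply (Algebra.TensorProduct.basis U c).repr.injective
  refine Finsupp.ext fun l => ?_
  -- each coordinate is a polynomial over the infinite field `F₀`, determined by its values
  apply MvPolynomial.funext
  intro q
  have key : ∀ P : U ⊗[F₀] K, MvPolynomial.eval q ((Algebra.TensorProduct.basis U c).repr P l) =
      (Algebra.TensorProduct.basis F₀ c).repr (LinearMap.rTensor K (MvPolynomial.aeval q).toLinearMap P) l := by
    intro P
    rw [basis_repr_rTensor, MvPolynomial.aeval_eq_eval₂Hom, Algebra.algebraMap_self]
    rfl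
  rw [key, key, ← hη, ← hθ, h]

end Density

section DensityAlgebra

variable {F₀ : Type} [Field F₀] [Infinite F₀]
variable {k K : Type} [CommRing k] [Algebra F₀ k] [Module.Finite F₀ k] [Ring K] [Algebra F₀ K]

omit [Infinite F₀] [Module.Finite F₀ k] in
/-- `(φ ⊗ 1)` on an algebra tensor product is `LinearMap.rTensor` of `φ` (pure tensors). [folklore] -/
private theorem algebraTensorProduct_map_id_apply {R S : Type} [CommRing R] [Algebra F₀ R] [CommRing S] [Algebra F₀ S]
    {A : Type} [Ring A] [Algebra F₀ A] (φ : R →ₐ[F₀] S) (x : R ⊗[F₀] A) :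
    Algebra.TensorProduct.map φ (AlgHom.id F₀ A) x = LinearMap.rTensor A φ.toLinearMap x := by
  induction x using TensorProduct.induction_on with
  | zero => rw [map_zero, map_zero]
  | tmul r a => rw [Algebra.TensorProduct.map_tmul, LinearMap.rTensor_tmul, AlgHom.id_apply, AlgHom.toLinearMap_apply]
  | add x y hx hy => rw [map_add, map_add, hx, hy]

/-- **The density lemma for algebras**, naturality phrased with `Algebra.TensorProduct.map φ (AlgHom.id F₀ ·)` (the
form of `reflexNormPoints_map` / `normPoints_map`): two families `η_R, θ_R : R ⊗ k → R ⊗ K` natural in the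
commutative `F₀`-algebra `R` that agree at `R = F₀` agree everywhere.
[cite: MilneCM2006, Ch. I §1 Rem. 1.25 («In terms of algebraic tori … by taking R = ℚ, ℚ_ℓ, ℝ»)] -/
theorem pointsMap_eq_of_natural_of_eq_base'
    (η θ : ∀ (R : Type) [CommRing R] [Algebra F₀ R], R ⊗[F₀] k → R ⊗[F₀] K)
    (hη : ∀ (R S : Type) [CommRing R] [Algebra F₀ R] [CommRing S] [Algebra F₀ S] (φ : R →ₐ[F₀] S)
      (x : R ⊗[F₀] k), η S (Algebra.TensorProduct.map φ (AlgHom.id F₀ k) x) =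
        Algebra.TensorProduct.map φ (AlgHom.id F₀ K) (η R x))
    (hθ : ∀ (R S : Type) [CommRing R] [Algebra F₀ R] [CommRing S] [Algebra F₀ S] (φ : R →ₐ[F₀] S)
      (x : R ⊗[F₀] k), θ S (Algebra.TensorProduct.map φ (AlgHom.id F₀ k) x) =
        Algebra.TensorProduct.map φ (AlgHom.id F₀ K) (θ R x))
    (h : ∀ a : k, η F₀ (1 ⊗ₜ a) = θ F₀ (1 ⊗ₜ a))
    (R : Type) [CommRing R] [Algebra F₀ R] (x : R ⊗[F₀] k) : η R x = θ R x := by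
  refine pointsMap_eq_of_natural_of_eq_base η θ (fun R S _ _ _ _ φ x => ?_) (fun R S _ _ _ _ φ x => ?_)
    (fun y => ?_) R x
  · rw [← algebraTensorProduct_map_id_apply, ← algebraTensorProduct_map_id_apply, hη]
  · rw [← algebraTensorProduct_map_id_apply, ← algebraTensorProduct_map_id_apply, hθ]
  · have hy : y = (1 : F₀) ⊗ₜ[F₀] (TensorProduct.lid F₀ k y) := by
      rw [← TensorProduct.lid_symm_apply, LinearEquiv.symm_apply_apply]
    rw [hy, h]

end DensityAlgebra

/-! ## §4 PROPOSITION 1.23 on `R`-points: `N_{k,Φ}(R) = N_Φ(R) ∘ Nm_{k⊗R/E*⊗R}` -/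

section Transitivity

variable (K : Type) [Field K] [NumberField K] (Φ : CMType K) (k : IntermediateField ℚ ℂ) [FiniteDimensional ℚ k]
  [Algebra (traceField Φ) k]

/-- `k` is finite over `E*` (it is finite over `ℚ`, and `ℚ → E* → k` is a scalar tower — ring homomorphisms out of
`ℚ` being unique, Mathlib infers `IsScalarTower ℚ E* k`). [cite: MilneCM2006, Ch. I §1 Prop. 1.23 («any number field k with E* ⊂ k»)] -/
instance moduleFinite_traceField : Module.Finite (traceField Φ) k :=
  Module.Finite.of_restrictScalars_finite ℚ (traceField Φ) k

variable [IsScalarTower (traceField Φ) k ℂ]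
variable (R : Type) [CommRing R] [Algebra ℚ R]

/-- **PROPOSITION 1.23 ON `R`-POINTS (the torus form of Rem. 1.25): `N_{k,Φ}(R)(x) = N_Φ(R)(Nm_{k⊗R/E*⊗R}(x))`**
for every commutative `ℚ`-algebra `R` and every `x ∈ R ⊗_ℚ k` — «`N_{k,Φ} = N_Φ ∘ Nm_{k/E*}` (7)» read as an
identity of homomorphisms of tori `T^k → T^E`, i.e. on `R`-points for all `R` (Milne's `N_ℓ`, `N_∞` and the idèlic
map of Rem. 1.25 are the cases `R = ℚ_ℓ, ℝ, 𝔸_ℚ`).  Here `N_{k,Φ}(R) = reflexNormPoints K Φ k R`,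
`N_Φ(R) = reflexNormPoints K Φ E* R` (`E* = traceField Φ`) and `Nm_{k/E*}` on `R`-points is `normPoints E* k R`
(§1; `= Algebra.norm (R ⊗ E*)`, §2).  PROOF: both sides are natural in `R` (`reflexNormPoints_map`,
`normPoints_map`) and agree at `R = ℚ` by (7) for elements (`reflexNormFrom_eq_reflexNormFrom_traceField_norm`,
through `reflexNormPoints_one_tmul`, `normPoints_one_tmul`); conclude by the density lemma §3.  (The printed proof
computes `N_{k,Φ}(R)` with `V′ = k ⊗_{E*} V_Φ` instead.) [cite: MilneCM2006, Ch. I §1 Prop. 1.23 (7) and Rem. 1.25] -/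
theorem reflexNormPoints_eq_reflexNormPoints_traceField_normPoints (x : R ⊗[ℚ] k) :
    reflexNormPoints K Φ k R x =
      reflexNormPoints K Φ (traceField Φ) R (normPoints (traceField Φ) k R x) := by
  refine pointsMap_eq_of_natural_of_eq_base' (F₀ := ℚ) (k := k) (K := K)
    (fun R _ _ x => reflexNormPoints K Φ k R x)
    (fun R _ _ x => reflexNormPoints K Φ (traceField Φ) R (normPoints (traceField Φ) k R x))
    (fun R S _ _ _ _ φ x => reflexNormPoints_map K Φ k R φ x)
    (fun R S _ _ _ _ φ x => by
      rw [normPoints_map, reflexNormPoints_map])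
    (fun a => by
      rw [reflexNormPoints_one_tmul, normPoints_one_tmul, reflexNormPoints_one_tmul,
        reflexNormFrom_eq_reflexNormFrom_traceField_norm K Φ k a])
    R x

/-- **(7) as an identity of monoid homomorphisms on `R`-points: `N_{k,Φ}(R) = N_Φ(R) ∘ Nm_{k/E*}(R)`.**
[cite: MilneCM2006, Ch. I §1 Prop. 1.23 (7) and Rem. 1.25] -/
theorem reflexNormPoints_eq_comp_normPoints :
    reflexNormPoints K Φ k R = (reflexNormPoints K Φ (traceField Φ) R).comp (normPoints (traceField Φ) k R) :=
  MonoidHom.ext fun x => reflexNormPoints_eq_reflexNormPoints_traceField_normPoints K Φ k R x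

/-- **(7) on invertible elements — the printed `N_{k,Φ}(R) : (k ⊗_ℚ R)^× → (E ⊗_ℚ R)^×` factors as
`(k ⊗ R)^× → (E* ⊗ R)^× → (E ⊗ R)^×`**: `reflexNormPointsUnits K Φ k R = reflexNormPointsUnits K Φ E* R ∘
normPointsUnits E* k R` (the `R`-points of the torus homomorphisms `T^k → T^{E*} → T^E`).
[cite: MilneCM2006, Ch. I §1 Prop. 1.23 (7) and Rem. 1.25 («N_{k,Φ} is a homomorphism T^k → T^E»)] -/
theorem reflexNormPointsUnits_eq_comp :
    reflexNormPointsUnits K Φ k R =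
      (reflexNormPointsUnits K Φ (traceField Φ) R).comp (normPointsUnits (traceField Φ) k R) := by
  refine MonoidHom.ext fun x => Units.ext ?_
  exact reflexNormPoints_eq_reflexNormPoints_traceField_normPoints K Φ k R x

/-- **(7) on `R`-points with `Nm_{k/E*}` read as Mathlib's relative norm** of the finite free `(R ⊗_ℚ E*)`-algebra
`R ⊗_ℚ k` (structure `pointsTowerAlgebra`, §2): `N_{k,Φ}(R)(x) = N_Φ(R)(Algebra.norm (R ⊗ E*) x)`.
[cite: MilneCM2006, Ch. I §1 Prop. 1.23 (7) and Rem. 1.25] -/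
theorem reflexNormPoints_eq_reflexNormPoints_traceField_norm (x : R ⊗[ℚ] k) :
    reflexNormPoints K Φ k R x =
      reflexNormPoints K Φ (traceField Φ) R
        (@Algebra.norm (R ⊗[ℚ] traceField Φ) (R ⊗[ℚ] k) _ _ (pointsTowerAlgebra (traceField Φ) k R) x) := by
  letI := pointsTowerAlgebra (traceField Φ) k R
  rw [norm_eq_normPoints, reflexNormPoints_eq_reflexNormPoints_traceField_normPoints]

end Transitivity

end Literature.NumberTheory.ComplexMultiplication

end
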